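import Summits.Ventures.PercRepro.GZSwapA
import Summits.Ventures.PercRepro.C026GoodDegreeBridge

/-!
# The blocker flip: mine-3's LEMMA of THEOREM B (the two-hub class of C-041) — p6, gen 22

mine-3's THEOREM B (proofs/MINE3-G23-card.md, MINE3-GLUING.md §40 (j)) proves ROW C-041 `(G⅔)` on
every skeleton in which the terminals are adjacent and every other neighbour of a terminal is one of
two hubs `h, h'` adjacent to both terminals.  Its STEP 2 is a lemma on the colourings `O` of the
hub graph `G⁺` alone (`c` the probe, `h, h'` the hubs; red = open, blue = closed):

  `#{O : c ~_red h, c ≁_red h'} ≤ #{O : c ≁_blue h', c ~_red h by a walk avoiding the blue cluster of h'}`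

— the K-swap `Ψ_{h'} = kSwap h'` (typer-1's GZSwapA: flip every edge at the RED cluster `K'` of `h'`)
injects the left set into the right one: `c ∉ K'`, so the red cluster of `c` (which holds `h`) is
disjoint from `K'`, a red `c`–`h` walk uses no edge at `K'` and is unchanged by the flip, where it
avoids `K'` = the blue cluster of `h'` in `Ψ_{h'}(O)` (`cluster_compl_kSwap`); and `c ≁_blue h'` in
the image for the same reason.  The paper states the lemma with the extra condition `c ≁_blue h'` on
the left (`b ≤ X`); the version here drops it (stronger), and `card_blocked_le` / `card_blocked_le'`
are the two instances used in STEP 3 (`b ≤ X`, `b' ≤ X'`).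

* `not_mem_cluster_of_not_conn` — a vertex not joined to `h'` is outside the cluster of `h'`;
* `reflTransGen_avoiding_of_not_conn` — a red walk from `c` avoids the red cluster of a vertex `h'`
  not joined to `c`;
* `walkAvoiding_kSwap_of_not_conn` — the walk survives `Ψ_{h'}` and avoids the blue cluster of `h'`
  there;
* `card_conn_not_conn_le_walkAvoiding` — the injection, counted;
* `card_blocked_le`, `card_blocked_le'` — mine-3's `b ≤ X` and `b' ≤ X'` (with the `¬B`, `¬B'`
  conditions of the paper on the left).
-/

namespace PercRepro

namespace MultiGraph

open Finset

variable {V E : Type*} {G : MultiGraph V E}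

/-- A vertex not joined to `v` lies outside the cluster of `v`. -/
theorem not_mem_cluster_of_not_conn {ω : Config E} {u v : V} (h : ¬ G.Conn ω u v) :
    u ∉ G.cluster ω v := fun hu => h ((G.mem_cluster).1 hu).symm

/-- A red walk from `c` to `h` stays outside the red cluster of a vertex `h'` not joined to `c`. -/
theorem reflTransGen_avoiding_of_not_conn {ω : Config E} {c h h' : V} (hch' : ¬ G.Conn ω c h')
    (hch : G.Conn ω c h) :
    Relation.ReflTransGen (fun x y => G.OpenAdj ω x y ∧ y ∉ G.cluster ω h') c h := by
  unfold Conn at hch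
  induction hch with
  | refl => exact Relation.ReflTransGen.refl
  | @tail x y hcx hxy ih =>
    refine Relation.ReflTransGen.tail ih ⟨hxy, fun hy => hch' ?_⟩
    exact (Relation.ReflTransGen.tail hcx hxy).trans ((G.mem_cluster).1 hy).symm

/-- **The blocker flip keeps the `c`–`h` walk and makes it avoid the blue cluster of `h'`**: if
`c ~_red h` and `c ≁_red h'`, then in `Ψ_{h'}(O) = kSwap h' O` the vertex `h` is red-reachable from
`c` by a walk avoiding the blue cluster of `h'` (which is the old red cluster `K'` of `h'`). -/
theorem walkAvoiding_kSwap_of_not_conn {ω : Config E} {c h h' : V} (hch' : ¬ G.Conn ω c h')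
    (hch : G.Conn ω c h) :
    G.WalkAvoiding (G.kSwap h' ω) (G.cluster (G.kSwap h' ω)ᶜ h') c h := by
  rw [G.cluster_compl_kSwap]
  refine ⟨not_mem_cluster_of_not_conn hch', ?_⟩
  refine reflTransGen_avoiding_of_agree ?_ (not_mem_cluster_of_not_conn hch')
    (reflTransGen_avoiding_of_not_conn hch' hch)
  intro e h1 h2
  exact (G.kSwap_apply_of_notMem (by rw [mem_edgesAt]; exact not_or.2 ⟨h1, h2⟩)).symm

/-- In `Ψ_{h'}(O)` the probe is not blue-joined to `h'` when it was not red-joined to `h'` in `O`. -/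
theorem not_conn_compl_kSwap_of_not_conn {ω : Config E} {c h' : V} (hch' : ¬ G.Conn ω c h') :
    ¬ G.Conn (G.kSwap h' ω)ᶜ c h' := fun h =>
  hch' (((G.conn_compl_kSwap_iff h' c ω).1 h.symm).symm)

section Count

variable [Fintype E] [DecidableEq E]

open Classical in
/-- **mine-3's LEMMA (STEP 2 of THEOREM B), the strong form**: the K-swap at `h'` injects
`{c ~_red h, c ≁_red h'}` into `{c ≁_blue h', c ~_red h avoiding the blue cluster of h'}`. -/
theorem card_conn_not_conn_le_walkAvoiding (c h h' : V) :
    (univ.filter fun O : Config E => G.Conn O c h ∧ ¬ G.Conn O c h').card ≤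
      (univ.filter fun O : Config E =>
        ¬ G.Conn Oᶜ c h' ∧ G.WalkAvoiding O (G.cluster Oᶜ h') c h).card := by
  refine Finset.card_le_card_of_injOn (G.kSwap h') ?_ ?_
  · intro O hO
    simp only [coe_filter, mem_univ, true_and, Set.mem_setOf_eq] at hO ⊢
    exact ⟨not_conn_compl_kSwap_of_not_conn hO.2, walkAvoiding_kSwap_of_not_conn hO.2 hO.1⟩
  · intro O _ O' _ h
    exact G.kSwap_injective h' h

open Classical in
/-- mine-3's `b ≤ X`: `#{¬B, ¬B', R, ¬R'} ≤ #{¬B', R^{av}}` (notation of MINE3-G23-card.md: `R`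
= `c ~_red h`, `B'` = `c ~_blue h'`, `R^{av}` = `c ~_red h` avoiding the blue cluster of `h'`). -/
theorem card_blocked_le (c h h' : V) :
    (univ.filter fun O : Config E =>
        (¬ G.Conn Oᶜ c h ∧ ¬ G.Conn Oᶜ c h') ∧ G.Conn O c h ∧ ¬ G.Conn O c h').card ≤
      (univ.filter fun O : Config E =>
        ¬ G.Conn Oᶜ c h' ∧ G.WalkAvoiding O (G.cluster Oᶜ h') c h).card :=
  le_trans (Finset.card_le_card (fun O hO => by
    simp only [mem_filter, mem_univ, true_and] at hO ⊢
    exact hO.2)) (card_conn_not_conn_le_walkAvoiding c h h')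

open Classical in
/-- mine-3's `b' ≤ X'`: the same with the hubs exchanged. -/
theorem card_blocked_le' (c h h' : V) :
    (univ.filter fun O : Config E =>
        (¬ G.Conn Oᶜ c h ∧ ¬ G.Conn Oᶜ c h') ∧ G.Conn O c h' ∧ ¬ G.Conn O c h).card ≤
      (univ.filter fun O : Config E =>
        ¬ G.Conn Oᶜ c h ∧ G.WalkAvoiding O (G.cluster Oᶜ h) c h').card :=
  le_trans (Finset.card_le_card (fun O hO => by
    simp only [mem_filter, mem_univ, true_and] at hO ⊢
    exact hO.2)) (card_conn_not_conn_le_walkAvoiding c h' h)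

end Count

end MultiGraph

end PercRepro
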